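import Summits.RiemannHypothesis.RiemannHypothesis.Theorems.MotivicDoorCertPosConstrained
import Literature.Analysis.SpecialFunctions.CoffeyCsordas2013.Enclosures
import HarnessLib

/-!
# Motivic door / CERTPOS — PROVED enclosures of the polar constraint vectors (`rhdoor.certpos/2`)

pub-rhdoor (MOTIVIC-DOOR ticket), unit `certpos` (gen 2); honest framing as in `MotivicDoorCertPosConstrained`.
The constraint vectors of the Connes–Consani conditioned classes are explicit functions of `π` and the rational
half-width `a`: `polarGen (2a) n = 1/(1/4 + (πn/a)²)` (`n ≥ 1`; `polarGen _ 0 = 2√2`) and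
`oddPolarGen (2a) p = 2(πp/a)/(1/4 + (πp/a)²)`. This file turns Mathlib's 20-digit enclosure of `π`
(`Real.pi_gt_d20` / `Real.pi_lt_d20`, packaged as the rationals `piLo`/`piHi` of
`Literature.Analysis.SpecialFunctions.CoffeyCsordas2013.Enclosures`, reused) and of `√2` into DECIDABLE rational bracket checks `evenEnclOK` / `evenHeadEnclOK`
/ `oddEnclOK` on the integer data of a `ClassWitness`, and PROVES that a passing check gives `EnclosesVec` — so the
constraint-vector enclosure in a class cell is a theorem, not data (only the Gram enclosure of the penalised matrix is
DATA). Monotonicity used: `k ↦ 1/(1/4+k²)` antitone on `k ≥ 0`, `k ↦ 2k/(1/4+k²)` antitone on `k ≥ 1/2`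
(checked per entry as `1/2 ≤ piLo·p/a`). RH-free, `ζ`-free, no axioms.
-/

open Finset Matrix Real
open scoped BigOperators

set_option linter.dupNamespace false  -- the mandated namespace repeats `RiemannHypothesis`

namespace Summit.RiemannHypothesis.RiemannHypothesis.Theorems.MotivicDoor.CertPos

open Summit.RiemannHypothesis.RiemannHypothesis.Theorems.PfPersistence
open Summit.RiemannHypothesis.RiemannHypothesis.Theorems.PfPersistence.PolarRankOne
open Literature.Analysis.SpecialFunctions.CoffeyCsordas2013 (piLo piHi pi_mem_piLo_piHi)

/-- The odd-sector polar generator `h_p = 2k_p/(1/4 + k_p²)`, `k_p = 2πp/L`: `∫ η_p e^{−x/2} dx = √(ρ(L)/2) · h_p` for the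
odd basis `η_p = xiOdd L p` (dictionary in the module docstring; the odd twin of `polarGen`). [folklore] -/
noncomputable def oddPolarGen (L : ℝ) (p : ℕ) : ℝ := 2 * (2 * π * p / L) / Dk (2 * π * p / L)

/-- rational lower / upper values for `polarGen (2a) n`, `n ≥ 1`: `1/(1/4 + (π± n/a)²)`. [folklore] -/
def gLoQ (a : ℚ) (n : ℕ) : ℚ := 1 / (1 / 4 + (piHi * n / a) ^ 2)
/-- rational upper value for `polarGen (2a) n` (uses `piLo`). [folklore] -/
def gHiQ (a : ℚ) (n : ℕ) : ℚ := 1 / (1 / 4 + (piLo * n / a) ^ 2)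
/-- rational lower / upper values for `oddPolarGen (2a) p`: `2(π∓ p/a)/(1/4 + (π∓ p/a)²)` (antitone for `k ≥ 1/2`). [folklore] -/
def oLoQ (a : ℚ) (p : ℕ) : ℚ := 2 * (piHi * p / a) / (1 / 4 + (piHi * p / a) ^ 2)
/-- rational upper value for `oddPolarGen (2a) p` (uses `piLo`). [folklore] -/
def oHiQ (a : ℚ) (p : ℕ) : ℚ := 2 * (piLo * p / a) / (1 / 4 + (piLo * p / a) ^ 2)
/-- 20-digit rational enclosure of `√2`. [folklore] -/
def sqrt2LoQ : ℚ := 14142135623730950488 / 10000000000000000000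
/-- 20-digit rational enclosure of `√2`, upper end. [folklore] -/
def sqrt2HiQ : ℚ := 14142135623730950489 / 10000000000000000000

/-- PROVED: `sqrt2LoQ ≤ √2 ≤ sqrt2HiQ`. [folklore] -/
theorem sqrt2_mem : ((sqrt2LoQ : ℚ) : ℝ) ≤ Real.sqrt 2 ∧ Real.sqrt 2 ≤ ((sqrt2HiQ : ℚ) : ℝ) := by
  constructor
  · have e : ((sqrt2LoQ : ℚ) : ℝ) = Real.sqrt (((sqrt2LoQ : ℚ) : ℝ) ^ 2) :=
      (Real.sqrt_sq (by norm_num [sqrt2LoQ])).symm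
    rw [e]
    exact Real.sqrt_le_sqrt (by norm_num [sqrt2LoQ])
  · have e : ((sqrt2HiQ : ℚ) : ℝ) = Real.sqrt (((sqrt2HiQ : ℚ) : ℝ) ^ 2) :=
      (Real.sqrt_sq (by norm_num [sqrt2HiQ])).symm
    rw [e]
    exact Real.sqrt_le_sqrt (by norm_num [sqrt2HiQ])

/-- PROVED: `k ↦ 1/(1/4 + k²)` is antitone on `k ≥ 0`. [folklore] -/
theorem inv_Dk_anti {x y : ℝ} (hx : 0 ≤ x) (hxy : x ≤ y) : 1 / (1 / 4 + y ^ 2) ≤ 1 / (1 / 4 + x ^ 2) := by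
  apply one_div_le_one_div_of_le (by positivity)
  nlinarith [mul_nonneg hx (sub_nonneg.mpr hxy)]

/-- PROVED: `k ↦ 2k/(1/4 + k²)` is antitone on `k ≥ 1/2`. [folklore] -/
theorem hfun_anti {x y : ℝ} (hx : 1 / 2 ≤ x) (hxy : x ≤ y) :
    2 * y / (1 / 4 + y ^ 2) ≤ 2 * x / (1 / 4 + x ^ 2) := by
  rw [div_le_div_iff₀ (by positivity) (by positivity)]
  have h1 : 0 ≤ y - x := sub_nonneg.mpr hxy
  have h2 : 0 ≤ x * y - 1 / 4 := by nlinarith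
  nlinarith [mul_nonneg h1 h2]

/-- PROVED: for rational `a > 0` and `n ≥ 1`, `gLoQ a n ≤ polarGen (2a) n ≤ gHiQ a n`. [folklore] -/
theorem polarGen_mem (a : ℚ) (ha : 0 < a) (n : ℕ) (hn : n ≠ 0) :
    ((gLoQ a n : ℚ) : ℝ) ≤ polarGen (2 * (a : ℝ)) n ∧ polarGen (2 * (a : ℝ)) n ≤ ((gHiQ a n : ℚ) : ℝ) := by
  obtain ⟨hlo, hhi⟩ := pi_mem_piLo_piHi
  have ha' : (0 : ℝ) < (a : ℝ) := by exact_mod_cast ha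
  have hn' : (0 : ℝ) ≤ (n : ℝ) := Nat.cast_nonneg n
  have e : polarGen (2 * (a : ℝ)) n = 1 / (1 / 4 + (π * n / a) ^ 2) := by
    simp only [polarGen, hn, if_false, Dk]
    congr 2
    field_simp
  rw [e]
  have hpl : (0 : ℝ) ≤ ((piLo : ℚ) : ℝ) := by norm_num [piLo]
  constructor
  · have e2 : ((gLoQ a n : ℚ) : ℝ) = 1 / (1 / 4 + (((piHi : ℚ) : ℝ) * n / a) ^ 2) := by
      simp only [gLoQ]; push_cast; ring
    rw [e2]
    apply inv_Dk_anti (by positivity)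
    exact div_le_div_of_nonneg_right (mul_le_mul_of_nonneg_right hhi.le hn') ha'.le
  · have e2 : ((gHiQ a n : ℚ) : ℝ) = 1 / (1 / 4 + (((piLo : ℚ) : ℝ) * n / a) ^ 2) := by
      simp only [gHiQ]; push_cast; ring
    rw [e2]
    apply inv_Dk_anti (by positivity)
    exact div_le_div_of_nonneg_right (mul_le_mul_of_nonneg_right hlo.le hn') ha'.le

/-- PROVED: for rational `a > 0` with `1/2 ≤ piLo · p / a`, `oLoQ a p ≤ oddPolarGen (2a) p ≤ oHiQ a p`. [folklore] -/
theorem oddPolarGen_mem (a : ℚ) (ha : 0 < a) (p : ℕ) (hp : (1 : ℚ) / 2 ≤ piLo * p / a) :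
    ((oLoQ a p : ℚ) : ℝ) ≤ oddPolarGen (2 * (a : ℝ)) p ∧ oddPolarGen (2 * (a : ℝ)) p ≤ ((oHiQ a p : ℚ) : ℝ) := by
  obtain ⟨hlo, hhi⟩ := pi_mem_piLo_piHi
  have ha' : (0 : ℝ) < (a : ℝ) := by exact_mod_cast ha
  have hp' : (0 : ℝ) ≤ (p : ℝ) := Nat.cast_nonneg p
  have hx : (1 : ℝ) / 2 ≤ ((piLo : ℚ) : ℝ) * p / a := by
    have h' := (Rat.cast_le (K := ℝ)).mpr hp
    push_cast at h'
    linarith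
  have e : oddPolarGen (2 * (a : ℝ)) p = 2 * (π * p / a) / (1 / 4 + (π * p / a) ^ 2) := by
    simp only [oddPolarGen, Dk]
    have : 2 * π * (p : ℝ) / (2 * a) = π * p / a := by field_simp
    rw [this]
  rw [e]
  have h1 : ((piLo : ℚ) : ℝ) * p / a ≤ π * p / a :=
    div_le_div_of_nonneg_right (mul_le_mul_of_nonneg_right hlo.le hp') ha'.le
  have h2 : π * p / a ≤ ((piHi : ℚ) : ℝ) * p / a :=
    div_le_div_of_nonneg_right (mul_le_mul_of_nonneg_right hhi.le hp') ha'.le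
  constructor
  · have e2 : ((oLoQ a p : ℚ) : ℝ) = 2 * (((piHi : ℚ) : ℝ) * p / a) / (1 / 4 + (((piHi : ℚ) : ℝ) * p / a) ^ 2) := by
      simp only [oLoQ]; push_cast; ring
    rw [e2]
    exact hfun_anti (le_trans hx h1) h2
  · have e2 : ((oHiQ a p : ℚ) : ℝ) = 2 * (((piLo : ℚ) : ℝ) * p / a) / (1 / 4 + (((piLo : ℚ) : ℝ) * p / a) ^ 2) := by
      simp only [oHiQ]; push_cast; ring
    rw [e2]
    exact hfun_anti hx h1

/-- PROVED: from rational brackets to the witness enclosure form. [folklore] -/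
theorem encl_of_brackets {x lo hi : ℝ} {D : ℤ} {rD td : ℕ} (hlo : lo ≤ x) (hhi : x ≤ hi)
    (h1 : ((D : ℝ) - rD) ≤ 2 ^ td * lo) (h2 : 2 ^ td * hi ≤ (D : ℝ) + rD) :
    |x - (D : ℝ) / 2 ^ td| ≤ (rD : ℝ) / 2 ^ td := by
  have hT : (0 : ℝ) < 2 ^ td := by positivity
  have hlo' : ((D : ℝ) - rD) / 2 ^ td ≤ x := le_trans (by rw [div_le_iff₀ hT]; linarith) hlo
  have hhi' : x ≤ ((D : ℝ) + rD) / 2 ^ td := le_trans hhi (by rw [le_div_iff₀ hT]; linarith)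
  rw [sub_div] at hlo'
  rw [add_div] at hhi'
  rw [abs_sub_le_iff]
  constructor <;> linarith

namespace ClassWitness

variable (z : ClassWitness)

/-- KERNEL CHECK: entries `off .. off+N-1` of `z` enclose `polarGen (2a) (n₀), …, polarGen (2a) (n₀+N-1)` (modes `n₀+i`,
`n₀ ≥ 1`). [folklore] -/
def evenEnclOK (a : ℚ) (n₀ N off : ℕ) : Bool :=
  (List.range N).all fun i =>
    decide (((z.Di (off + i) : ℚ) - z.rDi (off + i)) ≤ 2 ^ z.td * gLoQ a (n₀ + i)) &&
    decide (2 ^ z.td * gHiQ a (n₀ + i) ≤ (z.Di (off + i) : ℚ) + z.rDi (off + i))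

/-- KERNEL CHECK: entry `off` of `z` encloses `polarGen (2a) 0 = 2√2`. [folklore] -/
def evenHeadEnclOK (off : ℕ) : Bool :=
  decide (((z.Di off : ℚ) - z.rDi off) ≤ 2 ^ z.td * (2 * sqrt2LoQ)) &&
    decide (2 ^ z.td * (2 * sqrt2HiQ) ≤ (z.Di off : ℚ) + z.rDi off)

/-- signed target brackets for `± oddPolarGen`: lower end. [folklore] -/
def oTargetLo (a : ℚ) (p : ℕ) (neg : Bool) : ℚ := if neg then -oHiQ a p else oLoQ a p
/-- signed target brackets for `± oddPolarGen`: upper end. [folklore] -/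
def oTargetHi (a : ℚ) (p : ℕ) (neg : Bool) : ℚ := if neg then -oLoQ a p else oHiQ a p

/-- KERNEL CHECK: entries `off .. off+N-1` of `z` enclose `σ · oddPolarGen (2a) p`, `p = 1..N`, `σ = ±1` (`neg`). [folklore] -/
def oddEnclOK (a : ℚ) (N off : ℕ) (neg : Bool) : Bool :=
  (List.range N).all fun i =>
    decide ((1 : ℚ) / 2 ≤ piLo * (i + 1 : ℕ) / a) &&
    decide (((z.Di (off + i) : ℚ) - z.rDi (off + i)) ≤ 2 ^ z.td * oTargetLo a (i + 1) neg) &&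
    decide (2 ^ z.td * oTargetHi a (i + 1) neg ≤ (z.Di (off + i) : ℚ) + z.rDi (off + i))

/-- PROVED: `evenEnclOK` ⇒ entrywise enclosure of `polarGen (2a) (n₀ + i)` at index `off + i`. [folklore] -/
theorem encl_of_evenEnclOK (a : ℚ) (ha : 0 < a) (n₀ N off : ℕ) (hn₀ : n₀ ≠ 0)
    (h : z.evenEnclOK a n₀ N off = true) (i : ℕ) (hi : i < N) :
    |polarGen (2 * (a : ℝ)) (n₀ + i) - (z.Di (off + i) : ℝ) / 2 ^ z.td| ≤ (z.rDi (off + i) : ℝ) / 2 ^ z.td := by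
  simp only [evenEnclOK, List.all_eq_true, List.mem_range, Bool.and_eq_true, decide_eq_true_eq] at h
  obtain ⟨h1, h2⟩ := h i hi
  obtain ⟨hlo, hhi⟩ := polarGen_mem a ha (n₀ + i) (by omega)
  have h1' : ((z.Di (off + i) : ℝ) - (z.rDi (off + i) : ℝ)) ≤ 2 ^ z.td * ((gLoQ a (n₀ + i) : ℚ) : ℝ) := by
    exact_mod_cast h1
  have h2' : 2 ^ z.td * ((gHiQ a (n₀ + i) : ℚ) : ℝ) ≤ (z.Di (off + i) : ℝ) + (z.rDi (off + i) : ℝ) := by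
    exact_mod_cast h2
  exact encl_of_brackets hlo hhi h1' h2'

/-- PROVED: `evenHeadEnclOK` ⇒ enclosure of `polarGen (2a) 0` at index `off`. [folklore] -/
theorem encl_of_evenHeadEnclOK (a : ℝ) (off : ℕ) (h : z.evenHeadEnclOK off = true) :
    |polarGen (2 * a) 0 - (z.Di off : ℝ) / 2 ^ z.td| ≤ (z.rDi off : ℝ) / 2 ^ z.td := by
  simp only [evenHeadEnclOK, Bool.and_eq_true, decide_eq_true_eq] at h
  obtain ⟨h1, h2⟩ := h
  obtain ⟨slo, shi⟩ := sqrt2_mem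
  have e : polarGen (2 * a) 0 = 2 * Real.sqrt 2 := by simp [polarGen]
  rw [e]
  have h1' : ((z.Di off : ℝ) - (z.rDi off : ℝ)) ≤ 2 ^ z.td * (2 * ((sqrt2LoQ : ℚ) : ℝ)) := by exact_mod_cast h1
  have h2' : 2 ^ z.td * (2 * ((sqrt2HiQ : ℚ) : ℝ)) ≤ (z.Di off : ℝ) + (z.rDi off : ℝ) := by exact_mod_cast h2
  exact encl_of_brackets (by linarith) (by linarith) h1' h2'

/-- the signed odd generator `± oddPolarGen`. [folklore] -/
noncomputable def sgnOdd (neg : Bool) (x : ℝ) : ℝ := if neg then -x else x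

/-- PROVED: `oddEnclOK` ⇒ entrywise enclosure of `± oddPolarGen (2a) (i+1)` at index `off + i`. [folklore] -/
theorem encl_of_oddEnclOK (a : ℚ) (ha : 0 < a) (N off : ℕ) (neg : Bool)
    (h : z.oddEnclOK a N off neg = true) (i : ℕ) (hi : i < N) :
    |sgnOdd neg (oddPolarGen (2 * (a : ℝ)) (i + 1))
      - (z.Di (off + i) : ℝ) / 2 ^ z.td| ≤ (z.rDi (off + i) : ℝ) / 2 ^ z.td := by
  simp only [oddEnclOK, List.all_eq_true, List.mem_range, Bool.and_eq_true, decide_eq_true_eq] at h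
  obtain ⟨⟨hp, h1⟩, h2⟩ := h i hi
  obtain ⟨hlo, hhi⟩ := oddPolarGen_mem a ha (i + 1) hp
  have h1' : ((z.Di (off + i) : ℝ) - (z.rDi (off + i) : ℝ)) ≤ 2 ^ z.td * ((oTargetLo a (i + 1) neg : ℚ) : ℝ) := by
    exact_mod_cast h1
  have h2' : 2 ^ z.td * ((oTargetHi a (i + 1) neg : ℚ) : ℝ) ≤ (z.Di (off + i) : ℝ) + (z.rDi (off + i) : ℝ) := by
    exact_mod_cast h2
  cases neg with
  | true =>
    simp only [oTargetLo, oTargetHi, sgnOdd, if_true, Rat.cast_neg] at h1' h2' ⊢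
    exact encl_of_brackets (neg_le_neg hhi) (neg_le_neg hlo) h1' h2'
  | false =>
    simp only [oTargetLo, oTargetHi, sgnOdd, Bool.false_eq_true, if_false] at h1' h2' ⊢
    exact encl_of_brackets hlo hhi h1' h2'

/-- **PROVED — the even-sector, centre-conditioned constraint vector** `i ↦ polarGen (2a) (i+1)` on `Fin N` (modes
`1..N`) is enclosed by `z` whenever `evenEnclOK a 1 N 0` passes. [folklore] -/
theorem enclosesVec_evenTail (a : ℚ) (ha : 0 < a) (N : ℕ) (h : z.evenEnclOK a 1 N 0 = true) :
    z.EnclosesVec (fun i : Fin N => polarGen (2 * (a : ℝ)) ((i : ℕ) + 1)) := by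
  intro i
  have := z.encl_of_evenEnclOK a ha 1 N 0 one_ne_zero h i i.isLt
  simpa [Nat.add_comm] using this

/-- **PROVED — the full even-sector constraint vector** `n ↦ polarGen (2a) n` on `Fin (N+1)`. [folklore] -/
theorem enclosesVec_evenFull (a : ℚ) (ha : 0 < a) (N : ℕ) (h0 : z.evenHeadEnclOK 0 = true)
    (h : z.evenEnclOK a 1 N 1 = true) :
    z.EnclosesVec (fun n : Fin (N + 1) => polarGen (2 * (a : ℝ)) n) := by
  have key : ∀ m : ℕ, m < N + 1 →
      |polarGen (2 * (a : ℝ)) m - (z.Di m : ℝ) / 2 ^ z.td| ≤ (z.rDi m : ℝ) / 2 ^ z.td := by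
    intro m hm
    cases m with
    | zero => exact z.encl_of_evenHeadEnclOK (a : ℝ) 0 h0
    | succ i =>
      have hiN : i < N := by omega
      have := z.encl_of_evenEnclOK a ha 1 N 1 one_ne_zero h i hiN
      simpa [Nat.add_comm] using this
  intro n
  exact key n n.isLt

/-- **PROVED — the odd-sector constraint vector** `i ↦ oddPolarGen (2a) (i+1)` on `Fin N`. [folklore] -/
theorem enclosesVec_odd (a : ℚ) (ha : 0 < a) (N : ℕ) (h : z.oddEnclOK a N 0 false = true) :
    z.EnclosesVec (fun i : Fin N => oddPolarGen (2 * (a : ℝ)) ((i : ℕ) + 1)) := by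
  intro i
  have := z.encl_of_oddEnclOK a ha N 0 false h i i.isLt
  simpa [sgnOdd] using this

end ClassWitness


end Summit.RiemannHypothesis.RiemannHypothesis.Theorems.MotivicDoor.CertPos
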